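import Summits.QuantumAdvantage.QuantumAdvantage.Theorems.WbwObfuscatedGluedTreesKowGenVocabulary
import Literature.Computability.QuantumComplexity.GluedTreesThm9View

/-!
# Stub `stub_coherent` — coherence of the evaluating walk model with the clear reference generator
# (crux `WbwObfuscatedGluedTrees`, stmt-QuantumAdvantage-2340; line `knowledge-of-walk-split`, STAGE 2; lead prover-line-stmt-QuantumAdvantage-2340-1)

Registered stub `stub_coherent` of the stage-2 skeleton `Cruxes/WbwObfuscatedGluedTrees/Lines/knowledge_of_walk_split.lean`
(target `KnowledgeOfWalkSplit.Generator.GeneratorTransfer`): for every master datum `D`, reference presentation `Γ₁`,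
obfuscator `O` and PRF scheme `P` with `GenAdmissible D O P` and `RefAdmissible D Γ₁ O`,
`Coherent evalModel (D.lineData Γ₁ P).gen₀ (D.lineData Γ₁ P).answer` — on EVERY seed the keyed answer `name(EXIT)` has
the instance's name length, is a VALID name of the clear reference instance `⟨code ⟨2N, Γ₁ ℓ k⟩, name(ENTRANCE)⟩` in the
evaluating walk model (the code decodes; `Γ₁ ≡ Γ` computes the neighbour predicate `nbrBit σ ν`; the answer string on
`name(EXIT) = ν EXIT` is `answerBits σ ν (ν EXIT)`, which decodes to the sorted names of EXIT's two children, a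
nonempty list), and differs from `name(ENTRANCE)`.  Side results: `nameVal_nameOfVal` (binary value of the `N`-bit
reading of `m < 2^N` is `m`), `ansLen_le_two_pow`, `answerOf_eq_answerBits`, `vecOf_vname`, `nbrNames_naming`,
`gluedTreesOracle_exit_ne_nil`, `evalNbrs_clear`.  Only clause (7) of `GenAdmissible` and clause (2) of
`RefAdmissible` are used. [folklore]; objects: ChildsEtAl2003 §2 (names, oracle, EXIT = root of the right tree).
-/

set_option linter.dupNamespace false


namespace Summit.QuantumAdvantage.QuantumAdvantage.Theorems.WbwObfuscatedGluedTrees.KnowledgeOfWalk.Generator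

open Literature.Computability.Cryptography Literature.Computability.Complexity Filter Asymptotics
open Literature.Computability.Cryptography.ObfuscatedGluedTrees
open Literature.Computability.QuantumComplexity
open Summit.QuantumAdvantage.QuantumAdvantage.Theorems.WbwObfuscatedGluedTrees.Negative (ClauseC)
open Summit.QuantumAdvantage.QuantumAdvantage.Theorems.WbwObfuscatedGluedTrees.KnowledgeOfWalk
  (WalkModel inst KnowledgeOfWalk WordHard Coherent genObf genClear keyed)
open Summit.QuantumAdvantage.QuantumAdvantage.Cruxes.WbwObfuscatedGluedTrees.KnowledgeOfWalkSplit (LineData)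

open Literature.Computability.QuantumComplexity.GluedTrees (Vertex CycleDatum nameVal nameOfVal nbrNames graph depth)

/-! ## Binary values of names -/

/-- The binary value of an `N`-bit name is below `2^N`. [folklore] -/
theorem nameVal_lt_two_pow {N : ℕ} (a : Fin N → Bool) : nameVal a < 2 ^ N := by
  let g : Fin N → Fin 2 := fun i => ⟨(a i).toNat, by cases a i <;> simp⟩
  have hval : nameVal a = (finFunctionFinEquiv g : ℕ) := by
    rw [finFunctionFinEquiv_apply]; rfl
  rw [hval]
  exact (finFunctionFinEquiv g).isLt

/-- Reading `N` bits of a number below `2^N` and evaluating them gives the number back. [folklore] -/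
theorem nameVal_nameOfVal {N m : ℕ} (hm : m < 2 ^ N) : nameVal (nameOfVal N m) = m := by
  have h := Literature.Computability.QuantumComplexity.GluedTrees.nameOfVal_nameVal (nameOfVal N m)
  have hlt := nameVal_lt_two_pow (nameOfVal N m)
  apply Nat.eq_of_testBit_eq
  intro i
  by_cases hi : i < N
  · have := congrFun h ⟨i, hi⟩
    simpa [nameOfVal] using this
  · have hNi : N ≤ i := not_lt.mp hi
    have h2 : 2 ^ N ≤ 2 ^ i := Nat.pow_le_pow_right (by norm_num) hNi
    rw [Nat.testBit_eq_false_of_lt (lt_of_lt_of_le hlt h2),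
      Nat.testBit_eq_false_of_lt (lt_of_lt_of_le hm h2)]

/-- `3N + 2 ≤ 2^N` for `4 ≤ N`: every answer position has an `N`-bit binary code. [folklore] -/
theorem ansLen_le_two_pow {N : ℕ} (hN : 4 ≤ N) : ansLen N ≤ 2 ^ N := by
  unfold ansLen
  induction N, hN using Nat.le_induction with
  | base => norm_num
  | succ N hN ih => rw [pow_succ]; omega

/-! ## The evaluating model on a clear instance -/

/-- At matching arity the query input is `Fin.append name position`. [folklore] -/
theorem queryInput_eq (N : ℕ) (y : List Bool) (t : ℕ) :
    queryInput N (N + N) y t = Fin.append (vecOf N y) (nameOfVal N t) := by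
  funext i
  simp [queryInput, i.isLt]

/-- A circuit computing the neighbour predicate `nbrBit σ ν` answers, bit by bit, the answer string
`answerBits σ ν name` (`4 ≤ N`, so that every position `t < 3N + 2` is read correctly off its binary code).
[folklore] -/
theorem answerOf_eq_answerBits {d N : ℕ} (hN : 4 ≤ N) (σ : CycleDatum d) (ν : Vertex d ↪ (Fin N → Bool))
    (C : Circuit (Fin (N + N))) (hC : ∀ x, C.eval x = nbrBit σ ν x) (y : List Bool) :
    answerOf N ⟨N + N, C⟩ y = answerBits σ ν (vecOf N y) := by
  apply List.ext_getElem
  · simp [answerOf]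
  intro t h₁ h₂
  have ht : t < ansLen N := by simpa [answerOf] using h₁
  simp only [answerOf, List.getElem_ofFn]
  rw [hC, queryInput_eq, nbrBit]
  have hl : (fun i => Fin.append (vecOf N y) (nameOfVal N t) (Fin.castAdd N i)) = vecOf N y := by
    funext i; exact Fin.append_left _ _ i
  have hr : (fun i => Fin.append (vecOf N y) (nameOfVal N t) (Fin.natAdd N i)) = nameOfVal N t := by
    funext i; exact Fin.append_right _ _ i
  rw [hl, hr, nameVal_nameOfVal (lt_of_lt_of_le ht (ansLen_le_two_pow hN)), List.getD_eq_getElem _ _ h₂]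

/-- A name string read as a bit vector is the naming. [folklore] -/
theorem vecOf_vname (P : PuncturablePRFScheme) (μ : ℕ) (k₁ k₂ : List Bool) (d : ℕ) (v : Vertex d) :
    vecOf (nameLen μ d) (vname P μ k₁ k₂ d v) = naming P μ k₁ k₂ d v := by
  funext i
  have hi : (i : ℕ) < (vname P μ k₁ k₂ d v).length := by simp
  simp only [vecOf]
  rw [List.getD_eq_getElem _ _ hi]
  change _ = (vname P μ k₁ k₂ d v).get _
  simp [List.get_eq_getElem]

/-- The neighbour-name set at the name of a vertex is the image of its neighbourhood (any name length).
[cite: ChildsEtAl2003, §4 (Game 1)] -/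
theorem nbrNames_naming {d N : ℕ} (σ : CycleDatum d) (ν : Vertex d ↪ (Fin N → Bool)) (v : Vertex d) :
    nbrNames σ ν (ν v) = ((graph d σ).neighborFinset v).map ν := by
  unfold nbrNames
  have : (Finset.univ.filter fun w => ν w = ν v) = {v} := by
    ext w; simp [ν.injective.eq_iff]
  rw [this, Finset.singleton_biUnion]

/-- The oracle lists a nonempty answer at the EXIT's name (the EXIT has two children; `1 ≤ d`).
[cite: ChildsEtAl2003, §2] -/
theorem gluedTreesOracle_exit_ne_nil {d N : ℕ} (hd : 1 ≤ d) (σ : CycleDatum d)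
    (ν : Vertex d ↪ (Fin N → Bool)) :
    gluedTreesOracle σ ν (ν (GluedTrees.exit d)) ≠ [] := by
  intro h
  have hlen := congrArg List.length h
  rw [gluedTreesOracle, List.length_map, Finset.length_sort, nbrNames_naming,
    Finset.card_image_of_injective _ Literature.Computability.QuantumComplexity.GluedTrees.nameVal_injective,
    Finset.card_map, SimpleGraph.card_neighborFinset_eq_degree,
    Literature.Computability.QuantumComplexity.GluedTrees.degree_of_depth_eq_zero σ (by simp) hd] at hlen
  simp at hlen

/-- The evaluating model's neighbour listing on a CLEAR instance `⟨code ⟨2N, C⟩, e⟩` with `|e| = N`, at a string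
of length `N`: decode succeeds and the listing is read off `C`'s answer string. [folklore] -/
theorem evalNbrs_clear {N : ℕ} (C : Circuit (Fin (N + N))) (e y : List Bool) (he : e.length = N)
    (hy : y.length = N) :
    evalNbrs (boolPair (encodeSizedCircuit ⟨N + N, C⟩) e) y = listing (namesOf N (answerOf N ⟨N + N, C⟩ y)) := by
  unfold evalNbrs
  simp only [boolUnpair_boolPair, decodeSC_encodeSizedCircuit, he, hy, and_self, if_true]

/-! ## The registered stub -/

/-- **STUB `stub_coherent` — coherence of the evaluating model with the clear reference generator.**  On every
seed `s` (key `k = s.take (4 t n)`, level `ℓ = |k| / 4`), the reference instance is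
`⟨code ⟨2N, Γ₁ ℓ k⟩, name(ENTRANCE)⟩` and the keyed answer is `name(EXIT)`: it has length `N = |name(ENTRANCE)|`
(`length_vname`); it is VALID — the code decodes, `Γ₁ ≡ Γ` computes `nbrBit σ ν` (`RefAdmissible` (2),
`GenAdmissible` (7)), so the answer string on `name(EXIT) = ν EXIT` is `answerBits σ ν (ν EXIT)`
(`answerOf_eq_answerBits`, `vecOf_vname`), which decodes (`decodeAnswer_answerBits`, `1 ≤ δ ℓ`) to the sorted
names of EXIT's two children, a nonempty list (`gluedTreesOracle_exit_ne_nil`); and it differs from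
`name(ENTRANCE)` (`vname_injective`, `entrance_ne_exit`). [folklore] -/
theorem stub_coherent :
    ∀ (D : MasterData) (Γ₁ : D.Presentation) (O : CircuitObfuscator) (P : PuncturablePRFScheme),
      GenAdmissible D O P → RefAdmissible D Γ₁ O →
      Coherent evalModel (D.lineData Γ₁ P).gen₀ (D.lineData Γ₁ P).answer := by
  intro D Γ₁ O P hadm href s
  obtain ⟨_, _, _, _, _, _, h7, _⟩ := hadm
  obtain ⟨_, r2, _⟩ := href
  -- the key and its level
  set k : List Bool := s.take (4 * D.t s.length) with hk
  set ℓ : ℕ := k.length / 4 with hℓ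
  have hgen : (D.lineData Γ₁ P).gen₀ s =
      boolPair (encodeSizedCircuit ⟨D.Nℓ ℓ + D.Nℓ ℓ, Γ₁ ℓ k⟩) (D.entranceNameℓ P ℓ k) := rfl
  have hans : (D.lineData Γ₁ P).answer s = D.exitNameℓ P ℓ k := rfl
  have hNe : (D.entranceNameℓ P ℓ k).length = D.Nℓ ℓ := length_vname _ _ _ _ _ _
  have hNx : (D.exitNameℓ P ℓ k).length = D.Nℓ ℓ := length_vname _ _ _ _ _ _
  rw [hgen, hans]
  refine ⟨?_, ?_, ?_⟩
  · -- length
    show (D.exitNameℓ P ℓ k).length = (boolUnpair (boolPair _ _)).2.length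
    rw [boolUnpair_boolPair, hNx, hNe]
  · -- validity
    show (evalNbrs (boolPair (encodeSizedCircuit ⟨D.Nℓ ℓ + D.Nℓ ℓ, Γ₁ ℓ k⟩) (D.entranceNameℓ P ℓ k))
      (D.exitNameℓ P ℓ k)).isSome = true
    rw [evalNbrs_clear _ _ _ hNe hNx, isSome_listing_iff]
    have hN4 : 4 ≤ D.Nℓ ℓ := by
      have := D.δ_pos ℓ
      simp only [MasterData.Nℓ, nameLen, labelLen]; omega
    set σ := cycleOf P (D.π ℓ) (MasterData.keyℓ ℓ k 2) (MasterData.keyℓ ℓ k 3) (D.δ ℓ) with hσ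
    set ν := naming P (D.π ℓ) (MasterData.keyℓ ℓ k 0) (MasterData.keyℓ ℓ k 1) (D.δ ℓ) with hν
    have hC : ∀ x, (Γ₁ ℓ k).eval x = nbrBit σ ν x := fun x => by
      rw [← (r2 ℓ k).2.2 x, h7 ℓ k x]
    rw [answerOf_eq_answerBits hN4 σ ν (Γ₁ ℓ k) hC, MasterData.exitNameℓ, vecOf_vname, namesOf,
      decodeAnswer_answerBits (D.δ_pos ℓ)]
    intro h
    exact gluedTreesOracle_exit_ne_nil (D.δ_pos ℓ) σ ν (List.map_eq_nil_iff.mp h)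
  · -- not the entrance
    show D.exitNameℓ P ℓ k ≠ (boolUnpair (boolPair _ _)).2
    rw [boolUnpair_boolPair]
    intro h
    exact (GluedTrees.entrance_ne_exit (D.δ ℓ)).symm (vname_injective P _ _ _ _ h)

end Summit.QuantumAdvantage.QuantumAdvantage.Theorems.WbwObfuscatedGluedTrees.KnowledgeOfWalk.Generator
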